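import Mathlib
import HarnessLib

/-!
# Hitting probabilities of an adapted chain dominated through a kernel bound (Lyapunov bound)

Topic `Probability/Process`; theorems only (SLE-free). This is the abstract probabilistic step of
the "sum over all orderings of the hitting times" arguments in V. Beffara, *The dimension of the
SLE curves*, Ann. Probab. 36 (2008): proof of Lemma 8 (ii), pp. 1437–1439 and Remark 2, p. 1439
("one can couple it with a discrete-time Markov chain `(Mᵢ, Lᵢ)` in `Ω₁ = ℕ² ∪ {Δ}` … transition
probabilities given by … `≤ C a^{ηm + (8/κ-1)Mᵢ/2 + (1-κ/8)l}` … The probability estimate … is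
then bounded above by the probability that this Markov chain, started at `(0, 0)`, reaches the
domain `D_{k₁,k₂}` … Such a probability can be estimated by summing the probabilities of all
possible paths … or by finding an appropriate super-harmonic function on `ℕ²`"), and of §3.2,
pp. 1441–1447 (the quadruples `(Jᵢ, Kᵢ, J'ᵢ, K'ᵢ)` read at the task times `Sᵢ`, with the
conditional bounds (3.6)–(3.10): "All we need to do then is to estimate the probability that
`(Kᵢ, K'ᵢ)` reaches `(n̄, n̄)`. With this formulation, it would be nice to give a super-harmonic
function associated to the process").

The setting is deliberately bare: a measure `P` on `Ω`, an increasing sequence of σ-algebras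
`m n ≤ mΩ` (in the application `m n = 𝓕_{Sₙ}`), states `X n : Ω → σ` in a countable state space,
`X n` measurable for `m n`, and a KERNEL BOUND `q : σ → σ → ℝ≥0∞` on the one-step conditional
probabilities in the set form delivered by strong-Markov estimates:

  `P(A ∩ {X n = x} ∩ {X (n+1) = y}) ≤ q x y · P(A ∩ {X n = x})` for every `A ∈ m n`.

Nothing is assumed on `∑_y q x y` (the bounds are typically vacuous for small jumps), the chain
need not be Markov, and it may die (send it to a cemetery state `∂` with `h ∂ = 0`).

* `setLIntegral_comp_eq_tsum` — `∫⁻_{B} g(Y) dP = ∑' y, g y · P(B ∩ {Y = y})` for a countable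
  state space;
* `setLIntegral_succ_le_tsum_of_kernel_bound` — the one-step bound
  `∫⁻_A h(X (n+1)) ≤ ∑' x, (∑' y, q x y · h y) · P(A ∩ {X n = x})`, `A ∈ m n`;
* `setLIntegral_succ_le_of_superharmonic` — if `∑' y, q x y · h y ≤ h x` off a target set `T` and
  `A ∈ m n`, `A ⊆ {X n ∉ T}`, then `∫⁻_A h(X (n+1)) ≤ ∫⁻_A h(X n)` (the supermartingale step);
* `measure_exists_le_mem_le_lintegral` / **`measure_exists_mem_le_lintegral_of_superharmonic`** —
  the LYAPUNOV BOUND: if moreover `1 ≤ h` on `T`, then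
  `P(∃ n, X n ∈ T) ≤ ∫⁻ h(X 0) dP`; in particular `≤ h x₀ · P(Ω)` when `X 0 ≡ x₀`
  (`measure_exists_mem_le_mul_of_superharmonic`).

The minimal such `h` is the sum over paths of the products of the `q`'s (Beffara's "summing the
probabilities of all possible paths"); any explicit super-harmonic `h` gives a bound without the
path combinatorics.

## References

* V. Beffara, *The dimension of the SLE curves*, Ann. Probab. 36 (2008), Lemma 8 (ii) and
  Remarks 1–2 (pp. 1437–1440), §3.2 (3.6)–(3.10) and pp. 1444–1447.
* D. Revuz, M. Yor, *Continuous Martingales and Brownian Motion* (1999), Ch. II (1.6): positive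
  supermartingales and hitting probabilities (the discrete Lyapunov inequality).
-/

noncomputable section

open Set Filter MeasureTheory
open scoped ENNReal Topology

namespace Literature.Probability.Process

variable {Ω σ : Type*} {mΩ : MeasurableSpace Ω} {P : Measure Ω}
  [MeasurableSpace σ] [Countable σ] [MeasurableSingletonClass σ]

/-! ### Integrals of functions of a countably-valued random variable -/

/-- **`∫⁻_B g(Y) dP = ∑_y g(y) P(B ∩ {Y = y})`** for a measurable `Y` with values in a countable
state space (every `g : σ → ℝ≥0∞` is measurable there). [folklore] -/
theorem setLIntegral_comp_eq_tsum {Y : Ω → σ} (hY : Measurable Y) (g : σ → ℝ≥0∞) (B : Set Ω) :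
    ∫⁻ ω in B, g (Y ω) ∂P = ∑' y, g y * P (B ∩ Y ⁻¹' {y}) := by
  have hg : Measurable g := measurable_of_countable g
  rw [← lintegral_map hg hY, lintegral_countable']
  refine tsum_congr fun y ↦ ?_
  rw [Measure.map_apply hY (measurableSet_singleton y),
    Measure.restrict_apply (hY (measurableSet_singleton y)), inter_comm]

/-- The same over the whole space: `∫⁻ g(Y) dP = ∑_y g(y) P{Y = y}`. [folklore] -/
theorem lintegral_comp_eq_tsum {Y : Ω → σ} (hY : Measurable Y) (g : σ → ℝ≥0∞) :
    ∫⁻ ω, g (Y ω) ∂P = ∑' y, g y * P (Y ⁻¹' {y}) := by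
  have h := setLIntegral_comp_eq_tsum (P := P) hY g univ
  simpa only [Measure.restrict_univ, univ_inter] using h

/-! ### The one-step (supermartingale) inequality -/

variable {m : ℕ → MeasurableSpace Ω} {X : ℕ → Ω → σ} {q : σ → σ → ℝ≥0∞}

/-- **One step under the kernel bound.** If `X n` is `m n`-measurable, `X (n+1)` is measurable,
`m n ≤ mΩ`, and `P(A ∩ {X n = x} ∩ {X (n+1) = y}) ≤ q x y · P(A ∩ {X n = x})` for all `x, y` and
the given `A ∈ m n`, then for every `h : σ → ℝ≥0∞`,
`∫⁻_A h(X (n+1)) dP ≤ ∑_x (∑_y q x y · h y) · P(A ∩ {X n = x})`: partition `A` by the value of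
`X n`, then by the value of `X (n+1)`. [cite: Beffara2008, Lemma 8 (ii), p. 1437 ("applying the
strong Markov property at each of the times … we get an estimate of the conditional probability …
as a product of conditional probabilities")] -/
theorem setLIntegral_succ_le_tsum_of_kernel_bound {n : ℕ} (hmn : m n ≤ mΩ)
    (hXn : Measurable[m n] (X n)) (hXs : Measurable (X (n + 1))) {A : Set Ω}
    (hA : MeasurableSet[m n] A)
    (hq : ∀ x y, P (A ∩ X n ⁻¹' {x} ∩ X (n + 1) ⁻¹' {y}) ≤ q x y * P (A ∩ X n ⁻¹' {x}))
    (h : σ → ℝ≥0∞) :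
    ∫⁻ ω in A, h (X (n + 1) ω) ∂P ≤ ∑' x, (∑' y, q x y * h y) * P (A ∩ X n ⁻¹' {x}) := by
  have hXn' : Measurable (X n) := hXn.mono hmn le_rfl
  have hA' : MeasurableSet A := hmn _ hA
  have hpiece : ∀ x, MeasurableSet (A ∩ X n ⁻¹' {x}) := fun x ↦
    hA'.inter (hXn' (measurableSet_singleton x))
  -- partition `A` by the value of `X n`
  have hU : A = ⋃ x, A ∩ X n ⁻¹' {x} := by
    ext ω
    simp only [mem_iUnion, mem_inter_iff, mem_preimage, mem_singleton_iff]
    exact ⟨fun hω ↦ ⟨_, hω, rfl⟩, fun ⟨_, hω, _⟩ ↦ hω⟩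
  have hdisj : Pairwise (Function.onFun Disjoint fun x ↦ A ∩ X n ⁻¹' {x}) := by
    intro x x' hxx'
    refine disjoint_left.2 fun ω hω hω' ↦ hxx' ?_
    exact hω.2.symm.trans hω'.2
  calc ∫⁻ ω in A, h (X (n + 1) ω) ∂P
      = ∫⁻ ω in ⋃ x, A ∩ X n ⁻¹' {x}, h (X (n + 1) ω) ∂P := by rw [← hU]
    _ = ∑' x, ∫⁻ ω in A ∩ X n ⁻¹' {x}, h (X (n + 1) ω) ∂P := lintegral_iUnion hpiece hdisj _
    _ = ∑' x, ∑' y, h y * P (A ∩ X n ⁻¹' {x} ∩ X (n + 1) ⁻¹' {y}) :=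
        tsum_congr fun x ↦ setLIntegral_comp_eq_tsum hXs h _
    _ ≤ ∑' x, ∑' y, h y * (q x y * P (A ∩ X n ⁻¹' {x})) := by
        gcongr with x y
        exact hq x y
    _ = ∑' x, (∑' y, q x y * h y) * P (A ∩ X n ⁻¹' {x}) := by
        refine tsum_congr fun x ↦ ?_
        rw [← ENNReal.tsum_mul_right]
        refine tsum_congr fun y ↦ ?_
        ring

/-- **The supermartingale step.** Under the kernel bound on `A ∈ m n`, if `h` is
`q`-superharmonic off the target set `T` (`∑_y q x y · h y ≤ h x` for `x ∉ T`) and `X n ∉ T` on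
`A`, then `∫⁻_A h(X (n+1)) dP ≤ ∫⁻_A h(X n) dP`. [cite: Beffara2008, Remark 2 p. 1439
("finding an appropriate super-harmonic function")] -/
theorem setLIntegral_succ_le_of_superharmonic {n : ℕ} (hmn : m n ≤ mΩ)
    (hXn : Measurable[m n] (X n)) (hXs : Measurable (X (n + 1))) {A : Set Ω}
    (hA : MeasurableSet[m n] A)
    (hq : ∀ x y, P (A ∩ X n ⁻¹' {x} ∩ X (n + 1) ⁻¹' {y}) ≤ q x y * P (A ∩ X n ⁻¹' {x}))
    {T : Set σ} {h : σ → ℝ≥0∞} (hsuper : ∀ x ∉ T, ∑' y, q x y * h y ≤ h x)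
    (hAT : ∀ ω ∈ A, X n ω ∉ T) :
    ∫⁻ ω in A, h (X (n + 1) ω) ∂P ≤ ∫⁻ ω in A, h (X n ω) ∂P := by
  have hXn' : Measurable (X n) := hXn.mono hmn le_rfl
  refine (setLIntegral_succ_le_tsum_of_kernel_bound hmn hXn hXs hA hq h).trans ?_
  rw [setLIntegral_comp_eq_tsum hXn' h A]
  refine ENNReal.tsum_le_tsum fun x ↦ ?_
  by_cases hx : x ∈ T
  · -- the piece `A ∩ {X n = x}` is empty
    have hempty : A ∩ X n ⁻¹' {x} = ∅ := by
      refine eq_empty_of_forall_notMem fun ω hω ↦ hAT ω hω.1 ?_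
      have hx' : X n ω = x := hω.2
      rwa [hx']
    simp [hempty]
  · gcongr
    exact hsuper x hx

/-! ### The Lyapunov bound on hitting probabilities -/

/-- **Hitting the target by time `N` costs at most `∫ h(X 0)`.** Let `m` be increasing with
`m n ≤ mΩ`, `X n` measurable for `m n`, the kernel bound hold on every `A ∈ m n`, `h` be
`q`-superharmonic off `T` and `≥ 1` on `T`. Then for every `N`,
`P(∃ n ≤ N, X n ∈ T) ≤ ∫⁻ h(X 0) dP`. Proof: the quantity
`Uₙ = ∫⁻_{Gₙ} h(X n) + P(Gₙᶜ)`, `Gₙ = {∀ i ≤ n, X i ∉ T}`, is non-increasing in `n`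
(`setLIntegral_succ_le_of_superharmonic` on `Gₙ ∈ m n`, and `h ≥ 1` on `T` pays for the newly
hit paths), and `U₀ ≤ ∫⁻ h(X 0)`. [cite: Beffara2008, Remark 2 p. 1439–1440] -/
theorem measure_exists_le_mem_le_lintegral (hmono : Monotone m) (hm : ∀ n, m n ≤ mΩ)
    (hX : ∀ n, Measurable[m n] (X n))
    (hq : ∀ n (A : Set Ω), MeasurableSet[m n] A → ∀ x y,
      P (A ∩ X n ⁻¹' {x} ∩ X (n + 1) ⁻¹' {y}) ≤ q x y * P (A ∩ X n ⁻¹' {x}))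
    {T : Set σ} {h : σ → ℝ≥0∞} (hsuper : ∀ x ∉ T, ∑' y, q x y * h y ≤ h x)
    (hT : ∀ x ∈ T, 1 ≤ h x) (N : ℕ) :
    P {ω | ∃ n ≤ N, X n ω ∈ T} ≤ ∫⁻ ω, h (X 0 ω) ∂P := by
  have hX' : ∀ n, Measurable (X n) := fun n ↦ (hX n).mono (hm n) le_rfl
  have hTm : MeasurableSet T := T.to_countable.measurableSet
  -- `G n = {∀ i ≤ n, X i ∉ T}` is `m n`-measurable
  set G : ℕ → Set Ω := fun n ↦ {ω | ∀ i ≤ n, X i ω ∉ T} with hG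
  have hGm : ∀ n, MeasurableSet[m n] (G n) := by
    intro n
    have : G n = ⋂ i ∈ {i | i ≤ n}, (X i ⁻¹' T)ᶜ := by
      ext ω; simp [hG]
    rw [this]
    refine MeasurableSet.biInter (to_countable _) fun i hi ↦ MeasurableSet.compl ?_
    exact ((hX i).mono (hmono hi) le_rfl) hTm
  have hGm' : ∀ n, MeasurableSet (G n) := fun n ↦ hm n _ (hGm n)
  -- the complement of `G N` is the event in question
  have hcompl : ∀ n, (G n)ᶜ = {ω | ∃ i ≤ n, X i ω ∈ T} := by
    intro n; ext ω; simp [hG]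
  -- `U n = ∫⁻_{G n} h(X n) + P((G n)ᶜ)` is non-increasing
  set U : ℕ → ℝ≥0∞ := fun n ↦ ∫⁻ ω in G n, h (X n ω) ∂P + P (G n)ᶜ with hU
  have hstep : ∀ n, U (n + 1) ≤ U n := by
    intro n
    -- split `G n` according to `X (n+1) ∈ T` or not
    have hGsucc : G (n + 1) = G n ∩ (X (n + 1) ⁻¹' T)ᶜ := by
      ext ω
      simp only [hG, mem_setOf_eq, mem_inter_iff, mem_compl_iff, mem_preimage]
      constructor
      · intro hω
        exact ⟨fun i hi ↦ hω i (hi.trans (Nat.le_succ n)), hω (n + 1) le_rfl⟩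
      · rintro ⟨h1, h2⟩ i hi
        rcases hi.lt_or_eq with hlt | rfl
        · exact h1 i (Nat.lt_succ_iff.1 hlt)
        · exact h2
    have hGcsucc : (G (n + 1))ᶜ = (G n)ᶜ ∪ (G n ∩ X (n + 1) ⁻¹' T) := by
      rw [hGsucc]
      ext ω
      simp only [mem_union, mem_compl_iff, mem_inter_iff, mem_preimage]
      tauto
    have hTpiece : MeasurableSet (G n ∩ X (n + 1) ⁻¹' T) := (hGm' n).inter (hX' _ hTm)
    have hTcpiece : MeasurableSet (G n ∩ (X (n + 1) ⁻¹' T)ᶜ) := (hGm' n).inter (hX' _ hTm).compl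
    -- `P(G n ∩ {X (n+1) ∈ T}) ≤ ∫⁻ over it of h(X (n+1))` since `h ≥ 1` on `T`
    have hpay : P (G n ∩ X (n + 1) ⁻¹' T) ≤ ∫⁻ ω in G n ∩ X (n + 1) ⁻¹' T, h (X (n + 1) ω) ∂P := by
      calc P (G n ∩ X (n + 1) ⁻¹' T)
          = ∫⁻ _ in G n ∩ X (n + 1) ⁻¹' T, (1 : ℝ≥0∞) ∂P := by
            rw [setLIntegral_one]
        _ ≤ ∫⁻ ω in G n ∩ X (n + 1) ⁻¹' T, h (X (n + 1) ω) ∂P :=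
            setLIntegral_mono' hTpiece fun ω hω ↦ hT _ hω.2
    -- the supermartingale step on `G n`
    have hsm : ∫⁻ ω in G n, h (X (n + 1) ω) ∂P ≤ ∫⁻ ω in G n, h (X n ω) ∂P :=
      setLIntegral_succ_le_of_superharmonic (hm n) (hX n) (hX' (n + 1)) (hGm n) (hq n _ (hGm n))
        hsuper fun ω hω ↦ hω n le_rfl
    calc U (n + 1)
        = ∫⁻ ω in G n ∩ (X (n + 1) ⁻¹' T)ᶜ, h (X (n + 1) ω) ∂P + P (G (n + 1))ᶜ := by
          simp only [hU, hGsucc]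
      _ ≤ ∫⁻ ω in G n ∩ (X (n + 1) ⁻¹' T)ᶜ, h (X (n + 1) ω) ∂P +
            (P (G n)ᶜ + P (G n ∩ X (n + 1) ⁻¹' T)) := by
          rw [hGcsucc]
          gcongr
          exact measure_union_le _ _
      _ ≤ ∫⁻ ω in G n ∩ (X (n + 1) ⁻¹' T)ᶜ, h (X (n + 1) ω) ∂P +
            (P (G n)ᶜ + ∫⁻ ω in G n ∩ X (n + 1) ⁻¹' T, h (X (n + 1) ω) ∂P) := by
          gcongr
      _ = (∫⁻ ω in G n ∩ (X (n + 1) ⁻¹' T)ᶜ, h (X (n + 1) ω) ∂P +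
            ∫⁻ ω in G n ∩ X (n + 1) ⁻¹' T, h (X (n + 1) ω) ∂P) + P (G n)ᶜ := by ring
      _ = ∫⁻ ω in G n, h (X (n + 1) ω) ∂P + P (G n)ᶜ := by
          congr 1
          rw [← lintegral_union hTpiece]
          · congr 1
            rw [← inter_union_distrib_left, compl_union_self, inter_univ]
          · exact disjoint_left.2 fun ω hω hω' ↦ hω.2 hω'.2
      _ ≤ ∫⁻ ω in G n, h (X n ω) ∂P + P (G n)ᶜ := add_le_add hsm le_rfl
      _ = U n := rfl
  -- iterate, and bound `U 0`
  have hUle : ∀ n, U n ≤ U 0 := by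
    intro n
    induction n with
    | zero => exact le_rfl
    | succ n ih => exact (hstep n).trans ih
  have hU0 : U 0 ≤ ∫⁻ ω, h (X 0 ω) ∂P := by
    have hG0 : G 0 = (X 0 ⁻¹' T)ᶜ := by
      ext ω; simp [hG]
    have hT0 : MeasurableSet (X 0 ⁻¹' T) := hX' 0 hTm
    calc U 0 = ∫⁻ ω in (X 0 ⁻¹' T)ᶜ, h (X 0 ω) ∂P + P (X 0 ⁻¹' T) := by
          simp only [hU, hG0, compl_compl]
      _ ≤ ∫⁻ ω in (X 0 ⁻¹' T)ᶜ, h (X 0 ω) ∂P + ∫⁻ ω in X 0 ⁻¹' T, h (X 0 ω) ∂P := by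
          gcongr
          calc P (X 0 ⁻¹' T) = ∫⁻ _ in X 0 ⁻¹' T, (1 : ℝ≥0∞) ∂P := by rw [setLIntegral_one]
            _ ≤ ∫⁻ ω in X 0 ⁻¹' T, h (X 0 ω) ∂P := setLIntegral_mono' hT0 fun ω hω ↦ hT _ hω
      _ = ∫⁻ ω, h (X 0 ω) ∂P := by
          rw [add_comm, ← lintegral_union hT0.compl disjoint_compl_right, union_compl_self,
            Measure.restrict_univ]
  calc P {ω | ∃ n ≤ N, X n ω ∈ T} = P (G N)ᶜ := by rw [hcompl]
    _ ≤ U N := le_add_self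
    _ ≤ U 0 := hUle N
    _ ≤ ∫⁻ ω, h (X 0 ω) ∂P := hU0

/-- **The Lyapunov bound** (hitting at any time). Under the hypotheses of
`measure_exists_le_mem_le_lintegral`: `P(∃ n, X n ∈ T) ≤ ∫⁻ h(X 0) dP`. In Beffara's words, the
probability that the chain ever reaches the target domain is bounded by the value at the starting
point of a super-harmonic function which is `≥ 1` on the target; the minimal such function is the
sum over all paths of the products of the one-step bounds. [cite: Beffara2008, Remark 2
pp. 1439–1440; §3.2 p. 1444] -/
theorem measure_exists_mem_le_lintegral_of_superharmonic (hmono : Monotone m) (hm : ∀ n, m n ≤ mΩ)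
    (hX : ∀ n, Measurable[m n] (X n))
    (hq : ∀ n (A : Set Ω), MeasurableSet[m n] A → ∀ x y,
      P (A ∩ X n ⁻¹' {x} ∩ X (n + 1) ⁻¹' {y}) ≤ q x y * P (A ∩ X n ⁻¹' {x}))
    {T : Set σ} {h : σ → ℝ≥0∞} (hsuper : ∀ x ∉ T, ∑' y, q x y * h y ≤ h x)
    (hT : ∀ x ∈ T, 1 ≤ h x) :
    P {ω | ∃ n, X n ω ∈ T} ≤ ∫⁻ ω, h (X 0 ω) ∂P := by
  have hU : {ω | ∃ n, X n ω ∈ T} = ⋃ N, {ω | ∃ n ≤ N, X n ω ∈ T} := by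
    ext ω
    simp only [mem_setOf_eq, mem_iUnion]
    exact ⟨fun ⟨n, hn⟩ ↦ ⟨n, n, le_rfl, hn⟩, fun ⟨_, n, _, hn⟩ ↦ ⟨n, hn⟩⟩
  have hmonoN : Monotone fun N ↦ {ω | ∃ n ≤ N, X n ω ∈ T} :=
    fun N N' hNN' ω ⟨n, hn, hω⟩ ↦ ⟨n, hn.trans hNN', hω⟩
  rw [hU, hmonoN.measure_iUnion]
  exact iSup_le fun N ↦ measure_exists_le_mem_le_lintegral hmono hm hX hq hsuper hT N

/-- **The Lyapunov bound from a deterministic start**: if `X 0 ≡ x₀` then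
`P(∃ n, X n ∈ T) ≤ h x₀ · P(Ω)`. [cite: Beffara2008, Remark 2 p. 1439 ("this Markov chain,
started at `(0, 0)`, reaches the domain `D_{k₁,k₂}`")] -/
theorem measure_exists_mem_le_mul_of_superharmonic (hmono : Monotone m) (hm : ∀ n, m n ≤ mΩ)
    (hX : ∀ n, Measurable[m n] (X n))
    (hq : ∀ n (A : Set Ω), MeasurableSet[m n] A → ∀ x y,
      P (A ∩ X n ⁻¹' {x} ∩ X (n + 1) ⁻¹' {y}) ≤ q x y * P (A ∩ X n ⁻¹' {x}))
    {T : Set σ} {h : σ → ℝ≥0∞} (hsuper : ∀ x ∉ T, ∑' y, q x y * h y ≤ h x)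
    (hT : ∀ x ∈ T, 1 ≤ h x) {x₀ : σ} (h0 : ∀ ω, X 0 ω = x₀) :
    P {ω | ∃ n, X n ω ∈ T} ≤ h x₀ * P univ := by
  refine (measure_exists_mem_le_lintegral_of_superharmonic hmono hm hX hq hsuper hT).trans ?_
  simp only [h0, lintegral_const, le_refl]

end Literature.Probability.Process

end
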